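import Literature.NumberTheory.EllipticCurves.TunnellWaldspurgerSymmetricFamilyProofs
import HarnessLib

/-!
# `Tunnell1983_a_sq_propto_L_one` from two SIGNED symmetric families (odd case)

[[cite: Tunnell1983Congruent, proof of Thm 3, p. 329, ll. 7–19]] and
[[cite: Kohnen1985, §1, proof of Cor. 1 (the symmetry of `r(f; D, D')`)]] — the odd-case twin of
`TunnellConverseEvenOfSignedFamilies`: the symmetric-family lemma
`exists_sq_propto_of_symmetricFamily` is stated for an ABSTRACT coefficient function `c`, and a
level-`256` trivial-character Shintani lift delivers, on each class mod `8`, coefficients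
proportional to RE-SIGNED coefficients `s(m) a(m)` (`s(m) = ±1`, e.g. depending on `m mod 16`)
rather than to Tunnell's `a(m)` itself.  Since `s(D)² = 1` the conclusion
`a(D)² = c L(E_D, 1) √D` is unchanged: we PROVE
**`Tunnell1983_a_sq_propto_L_one_of_signedFamilies`** — for the classes `1` and `3 (mod 8)`
(auxiliary indices `D₀ = 1, 3`, where `L(E₁, 1) ≠ 0 ≠ L(E₃, 1)` are theorems of the tree), signed
families `R₁, R₃` with (H1) `R(D, m) = A_D s(m) a(m)`, (H2) `R(D, D₀) = R(D₀, D)`,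
(H3) `R(D, D) = κ L(E_D, 1) √D` with a FIXED `κ ≠ 0` per class, imply
`Literature.NumberTheory.EllipticCurves.Tunnell1983_a_sq_propto_L_one`.  (Unlike the converse
theorem, the proportionality statement needs `κ` independent of `D`; in the Shintani route this is
Gauss's sign `τ(χ_D) = √D`, `GaussSumJacobiChar`.)

No named facts, no new definitions.
-/

noncomputable section

open UpperHalfPlane hiding I
open Complex
open scoped NumberTheorySymbols

namespace Literature.NumberTheory.EllipticCurves.Tunnell1983

open Literature.NumberTheory.EllipticCurves.ModularForms

/-- **`Tunnell1983_a_sq_propto_L_one` from two SIGNED symmetric families**: as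
`Tunnell1983_a_sq_propto_L_one_of_symmetricFamilies`, but hypothesis (H1) reads
`R(D, m) = A_D · s(m) a(m)` with a sign `s(m)`, `s(m)² = 1`; the conclusion is unchanged since
`(s(D) a(D))² = a(D)²`. [cite: Tunnell1983Congruent, proof of Thm 3, p. 329, ll. 7–19]
[cite: Kohnen1985, §1, proof of Cor. 1] -/
theorem Tunnell1983_a_sq_propto_L_one_of_signedFamilies (R₁ R₃ : ℕ → ℕ → ℂ) (s : ℕ → ℂ)
    (hs : ∀ m : ℕ, s m ^ 2 = 1) {κ₁ κ₃ : ℂ} (hκ₁ : κ₁ ≠ 0) (hκ₃ : κ₃ ≠ 0)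
    (hA₁ : ∀ ⦃D : ℕ⦄, Squarefree D → D % 8 = 1 →
      ∃ A : ℂ, ∀ ⦃m : ℕ⦄, m % 8 = 1 → R₁ D m = A * (s m * (a m : ℂ)))
    (hsymm₁ : ∀ ⦃D : ℕ⦄, Squarefree D → D % 8 = 1 → R₁ D 1 = R₁ 1 D)
    (hdiag₁ : ∀ ⦃D : ℕ⦄, Squarefree D → D % 8 = 1 →
      (congruentNumberCurve D).HasEntireLFunction →
      R₁ D D = κ₁ * (congruentNumberCurve D).entireLFunction 1 * (Real.sqrt D : ℂ))
    (hA₃ : ∀ ⦃D : ℕ⦄, Squarefree D → D % 8 = 3 →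
      ∃ A : ℂ, ∀ ⦃m : ℕ⦄, m % 8 = 3 → R₃ D m = A * (s m * (a m : ℂ)))
    (hsymm₃ : ∀ ⦃D : ℕ⦄, Squarefree D → D % 8 = 3 → R₃ D 3 = R₃ 3 D)
    (hdiag₃ : ∀ ⦃D : ℕ⦄, Squarefree D → D % 8 = 3 →
      (congruentNumberCurve D).HasEntireLFunction →
      R₃ D D = κ₃ * (congruentNumberCurve D).entireLFunction 1 * (Real.sqrt D : ℂ)) :
    Tunnell1983_a_sq_propto_L_one := by
  have hL := @hasEntireLFunction_congruentNumberCurve_holds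
  have h3 : Squarefree 3 := Nat.prime_three.prime.squarefree
  obtain ⟨c₁, hc₁⟩ := exists_sq_propto_of_symmetricFamily R₁ (fun m ↦ s m * (a m : ℂ))
    (fun D ↦ (congruentNumberCurve D).entireLFunction 1)
    (fun D ↦ (congruentNumberCurve D).HasEntireLFunction) hκ₁ squarefree_one rfl
    (hL squarefree_one) entireLFunction_congruentNumberCurve_one_one_ne_zero hA₁ hsymm₁ hdiag₁
  obtain ⟨c₃, hc₃⟩ := exists_sq_propto_of_symmetricFamily R₃ (fun m ↦ s m * (a m : ℂ))
    (fun D ↦ (congruentNumberCurve D).entireLFunction 1)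
    (fun D ↦ (congruentNumberCurve D).HasEntireLFunction) hκ₃ h3 rfl
    (hL h3) entireLFunction_congruentNumberCurve_three_one_ne_zero hA₃ hsymm₃ hdiag₃
  have hsq : ∀ D : ℕ, (s D * (a D : ℂ)) ^ 2 = (a D : ℂ) ^ 2 := fun D ↦ by
    rw [mul_pow, hs, one_mul]
  refine ⟨c₁, c₃, fun D hD hLD ↦ ⟨fun h1 ↦ ?_, fun h3' ↦ ?_⟩⟩
  · rw [← hsq]; exact hc₁ hD h1 hLD
  · rw [← hsq]; exact hc₃ hD h3' hLD

/-- **Mixed shape**: class `1` delivered by a SIGNED family (trivial-character level-`256` lift of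
the level-`32` newform against the kernels `K_D`, `D ≡ 1 (mod 8)`), class `3` by an unsigned one
(whatever kernel serves `D ≡ 3 (mod 8)`); any combination reduces to the signed statement with
`s = 1` on the other class. Recorded as the specialisation `s₃ = 1`. [folklore] -/
theorem Tunnell1983_a_sq_propto_L_one_of_signedFamily_one (R₁ R₃ : ℕ → ℕ → ℂ) (s : ℕ → ℂ)
    (hs : ∀ m : ℕ, m % 8 = 1 → s m ^ 2 = 1) {κ₁ κ₃ : ℂ} (hκ₁ : κ₁ ≠ 0) (hκ₃ : κ₃ ≠ 0)
    (hA₁ : ∀ ⦃D : ℕ⦄, Squarefree D → D % 8 = 1 →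
      ∃ A : ℂ, ∀ ⦃m : ℕ⦄, m % 8 = 1 → R₁ D m = A * (s m * (a m : ℂ)))
    (hsymm₁ : ∀ ⦃D : ℕ⦄, Squarefree D → D % 8 = 1 → R₁ D 1 = R₁ 1 D)
    (hdiag₁ : ∀ ⦃D : ℕ⦄, Squarefree D → D % 8 = 1 →
      (congruentNumberCurve D).HasEntireLFunction →
      R₁ D D = κ₁ * (congruentNumberCurve D).entireLFunction 1 * (Real.sqrt D : ℂ))
    (hA₃ : ∀ ⦃D : ℕ⦄, Squarefree D → D % 8 = 3 →
      ∃ A : ℂ, ∀ ⦃m : ℕ⦄, m % 8 = 3 → R₃ D m = A * (a m : ℂ))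
    (hsymm₃ : ∀ ⦃D : ℕ⦄, Squarefree D → D % 8 = 3 → R₃ D 3 = R₃ 3 D)
    (hdiag₃ : ∀ ⦃D : ℕ⦄, Squarefree D → D % 8 = 3 →
      (congruentNumberCurve D).HasEntireLFunction →
      R₃ D D = κ₃ * (congruentNumberCurve D).entireLFunction 1 * (Real.sqrt D : ℂ)) :
    Tunnell1983_a_sq_propto_L_one := by
  -- the sign `s' = s` on the class `1`, `1` elsewhere
  set s' : ℕ → ℂ := fun m ↦ if m % 8 = 1 then s m else 1 with hs'
  have hs'sq : ∀ m : ℕ, s' m ^ 2 = 1 := fun m ↦ by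
    simp only [hs']
    split_ifs with h
    · exact hs m h
    · exact one_pow 2
  refine Tunnell1983_a_sq_propto_L_one_of_signedFamilies R₁ R₃ s' hs'sq hκ₁ hκ₃ ?_ hsymm₁ hdiag₁ ?_
    hsymm₃ hdiag₃
  · intro D hD hD1
    obtain ⟨A, hA⟩ := hA₁ hD hD1
    exact ⟨A, fun m hm ↦ by rw [hA hm]; simp [hs', hm]⟩
  · intro D hD hD3
    obtain ⟨A, hA⟩ := hA₃ hD hD3
    exact ⟨A, fun m hm ↦ by rw [hA hm]; simp [hs', hm]⟩

end Literature.NumberTheory.EllipticCurves.Tunnell1983
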